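import Literature.MathematicalPhysics.QuantumFieldTheory.Balaban1983to89.B9Thm312WholeH

/-!
# `Balaban1983to89.B9Eq3133SlotAH` — [B9] (3.133) p. 422 AT «SLOT (a)»: the two sup members of (3.133) for the minimizer map `H♭ = G₀Q*(QG₀Q*)⁻¹` built on
# Theorem 3.3's `G₀ = (Δ + DRD* + Q*aQ)⁻¹` (3.26)–(3.27) — print's `n = 0` TERM of Theorem 3.12's proof (3.130)–(3.131), from three letters and the co-reading

T. Bałaban, *Propagators for lattice gauge theories in a background field*, Commun. Math. Phys. **99** (1985) 389–434 [`Balaban1985BackgroundPropagators`, "B9"];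
[4] = T. Bałaban, *Propagators and renormalization transformations for lattice gauge theories. II*, Commun. Math. Phys. **96** (1984) 223–250 [`Balaban1984PropagatorsII`].

statement-level skeleton of published theorems with citation tags; proofs where landed; nothing here is a claim about the Yang–Mills mass gap

THE PRINTED LOCI (verbatim).  p. 420 (3.126): *"HB = GQ*(QGQ*)⁻¹B"*; p. 421: *"Let us denote for a moment the operator we have investigated in previous sections by G₀,
i.e. G₀ = (Δ + DRD* + Q*aQ)⁻¹. From (3.120) we get G = G₀(I − Δ′_πG₀)⁻¹ = Σ_{n=0}^∞ G₀(Δ′_πG₀)ⁿ. (3.130)"*; p. 422: *"|(QGQ*)⁻¹(y, y′)| ≦ O(1)(Lʲη)⁻²(L^{j′}η)^{−d}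
e^{−δ₁d(y,y′)} … (3.132) … The above inequality together with Theorem 3.3 for G … give |H_{μν}(x, y′)|, |∇H_{μν}(x, y′)| … ≦ O(1)[1, (Lʲη)⁻¹, …](L^{j′}η)^{−d}
e^{−½δ₁d(y,y′)} for x ∈ Δ(y) … (3.133)"*; p. 398: *"Using Lemma 2.1 in [4] we may replace the factor (Lʲη)^α by (Lʲη)^β(L^{j′}η)^γ with β + γ = α"*; [4] (2.60)–(2.61) p. 234.

WHY THIS FILE (cell `pub-ymgap`, node-00 custodian node00-def-Y g39's (J1) RULING of 2026-08-31: the (ℓa-H) letter of [B11] Prop. 4 at the BgScheme record sits at «SLOT (a)» —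
`H♭ = G₀Q*(QG₀Q*)⁻¹` on `G₀ = Δ_a⁻¹` of (3.26)–(3.27), NOT print's (3.126) `H` on `G̃` (3.122) or (3.129) `H₁` — so the N06 row that discharges it is «(3.133) AT SLOT (a), BY THE
METHOD of Thm 3.12»: the `n = 0` term of (3.130)).  `B9Thm312WholeH` (this seat's lineage, g2) proves the two sup members of (3.133) for `H = A∘(Q*C)` with `A = G₀ + G₀TA`
(Neumann step on `T = Δ′_π`); at slot (a) there is NO step (`T = 0`, `A = G₀`): the entries are ONE composition each — `G₀Q* ∘ C♭` and `∇_UG₀Q* ∘ C♭`, [4] (2.61) — so this file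
gives the step-free faces and assembles the `B9.Ineq3133` sup conjunct from the three letters `gQs2` (`G₀Q*`), `dgQs` (`∇_UG₀Q*`) and `c2♭` ((3.132)-analogue for
`C♭ = (QG₀Q*)⁻¹`, «can be analyzed in the same way as (Q′G′²Q′*)⁻¹»), the two `CoRealizesH` co-readings and the class transfer `ScaleTransfer` (p. 398's remark).
* §1 ★ `Hflat_entry0` (`G₀Q*C♭ : Z² → 𝔠⁽²⁾`, majorant `B₃²c·e^{−ρd}`), ★ `Hflat_entry1` (`∇_UG₀Q*C♭ : Z² → 𝔠_Y⁽¹⁾`, same constant) — `B11SectG.hasMaj_comp_exp` once each.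
* §2 ★★ `ineq3133flat_sup_of_letters` — the sup conjunct of `B9.Ineq3133` for ANY H-kernel co-read (`CoRealizesH`, n = 0 by `G₀Q*C♭`, n = 1 by `∇_UG₀Q*C♭`): constant
  `C = B₃²c·Λ`, rate `δ₁ := 2(1−α)ρ` (`hk_e0∕e1_of_hasMaj` + `ineq3133_sup_of_entries` of `B9Thm312WholeH`).
HONEST SCOPE.  Hypotheses of printed∕definitional shape (the three letters = Theorem 3.3's `G₀Q*` entries and the (3.132)-analogue; the co-readings; [4] (2.60)∕(2.61));
nothing of print asserted; the Hölder member ‖ζ∇H♭(·,y′)‖_β NOT treated.  NOT a node discharge; count-neutral; one finite lattice at a time; nothing continuum, nothing about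
the mass gap.  Cell `pub-ymgap` (HUMAN RULING D-0062), Track A node N06 [B9] ∕ K0ᴬ junction (ℓa-H)+(KL-H) ⇐ slot (a); seat `pub-ymgap-dag-n06-l` (g42), 2026-08-31.  NEW file;
nothing landed is modified.
-/

namespace Literature.MathematicalPhysics.QuantumFieldTheory.Balaban1983to89.B9Eq3133SlotAH

open Literature.MathematicalPhysics.QuantumFieldTheory.Balaban1983to89
open B6RandomWalk B9Thm34Ext B11SectG B9FromB6 B9FromB6ModelSignsOn B9Thm312Whole B9Thm312WholeH

noncomputable section

variable {g : B9.Geometry} {B : B9.Backgrounds} {X Y Z : Type}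
variable [Fintype X] [Fintype Y] [Fintype Z] [Fintype g.Site]

/-! ## §1 The two step-free entries of `H♭ = G₀Q*C♭` -/

omit [Fintype Y] in
/-- ★ **`H♭ = G₀Q*∘C♭ : Z² → 𝔠⁽²⁾`**: `G₀Q* : Z⁰ → 𝔠⁽²⁾` (`B₃e^{−δ₃d}`) after `C♭ = (QG₀Q*)⁻¹ : Z² → Z⁰` (`B₃e^{−δ₃d}`) has the majorant `B₃²c·e^{−ρd}` for `ρ + σ ≤ δ₃`, `c` the
[4]-(2.61) row-sum constant at rate `σ ≥ 0` — print's n = 0 term of (3.130) read in (3.126). [cite: Balaban1985BackgroundPropagators, (3.126) p.420 + (3.130) p.421 + (3.132) p.422; Balaban1984PropagatorsII, Lemma 2.1 (2.61) p.234] -/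
theorem Hflat_entry0 {R₀ : ℝ} {H₀ : Prop} (hG : GeoOK g) {blk : X → g.Site} {blkZ : Z → g.Site} {G0 : Module.End ℝ (X → ℝ)}
    {Qs : (Z → ℝ) →ₗ[ℝ] (X → ℝ)} {Cop : Module.End ℝ (Z → ℝ)} {B₃ δ₃ ρ σ c : ℝ} (hrow : RowSum (toB6 g R₀ H₀) σ c)
    (hB₃ : 0 ≤ B₃) (hσ : 0 ≤ σ) (hρ : 0 ≤ ρ) (hρ₃ : ρ + σ ≤ δ₃)
    (hQs : HasMaj (cNorm R₀ H₀ blkZ hG.lenle 0) (cNorm R₀ H₀ blk hG.lenle 2) (G0 ∘ₗ Qs) (fun a b => B₃ * Real.exp (-(δ₃ * g.dist a b))))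
    (hCop : HasMaj (cNorm R₀ H₀ blkZ hG.lenle 2) (cNorm R₀ H₀ blkZ hG.lenle 0) Cop (fun a b => B₃ * Real.exp (-(δ₃ * g.dist a b)))) :
    HasMaj (cNorm R₀ H₀ blkZ hG.lenle 2) (cNorm R₀ H₀ blk hG.lenle 2) (G0 ∘ₗ (Qs ∘ₗ Cop))
      (fun a b => B₃ * B₃ * c * Real.exp (-(ρ * g.dist a b))) := by
  have htri : Triangle254 (toB6 g R₀ H₀) := fun a b c => hG.tri a b c
  have hS : HasMaj (cNorm R₀ H₀ blkZ hG.lenle 2) (cNorm R₀ H₀ blk hG.lenle 2) (G0 ∘ₗ (Qs ∘ₗ Cop))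
      (fun a b => (cNorm R₀ H₀ blkZ hG.lenle 0 (X := Z)).κ * B₃ * B₃ * c * Real.exp (-(ρ * g.dist a b))) :=
    hasMaj_comp_exp htri hG.dnn hrow hB₃ hB₃ hρ (by linarith) hρ₃ hQs hCop
  simpa only [cNorm_κ, one_mul] using hS

omit [Fintype X] in
/-- ★ **`∇_UH♭ = ∇_UG₀Q*∘C♭ : Z² → 𝔠_Y⁽¹⁾`**: `∇_UG₀Q* : Z⁰ → 𝔠_Y⁽¹⁾` (`B₃e^{−δ₃d}`) after `C♭ : Z² → Z⁰` (`B₃e^{−δ₃d}`) has the majorant `B₃²c·e^{−ρd}` — at slot (a) the derivative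
entry is ONE composition too (no `(∇_UG₀Δ′_π)(H)` term: `T = 0`). [cite: Balaban1985BackgroundPropagators, (3.133) p.422 + (3.126) p.420 + (3.130) p.421; Balaban1984PropagatorsII, Lemma 2.1 (2.61) p.234] -/
theorem Hflat_entry1 {R₀ : ℝ} {H₀ : Prop} (hG : GeoOK g) {blkY : Y → g.Site} {blkZ : Z → g.Site} {G0 : Module.End ℝ (X → ℝ)}
    {Dop : (X → ℝ) →ₗ[ℝ] (Y → ℝ)} {Qs : (Z → ℝ) →ₗ[ℝ] (X → ℝ)} {Cop : Module.End ℝ (Z → ℝ)} {B₃ δ₃ ρ σ c : ℝ}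
    (hrow : RowSum (toB6 g R₀ H₀) σ c) (hB₃ : 0 ≤ B₃) (hσ : 0 ≤ σ) (hρ : 0 ≤ ρ) (hρ₃ : ρ + σ ≤ δ₃)
    (hDQs : HasMaj (cNorm R₀ H₀ blkZ hG.lenle 0) (cNorm R₀ H₀ blkY hG.lenle 1) (Dop ∘ₗ G0 ∘ₗ Qs)
      (fun a b => B₃ * Real.exp (-(δ₃ * g.dist a b))))
    (hCop : HasMaj (cNorm R₀ H₀ blkZ hG.lenle 2) (cNorm R₀ H₀ blkZ hG.lenle 0) Cop (fun a b => B₃ * Real.exp (-(δ₃ * g.dist a b)))) :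
    HasMaj (cNorm R₀ H₀ blkZ hG.lenle 2) (cNorm R₀ H₀ blkY hG.lenle 1) (Dop ∘ₗ G0 ∘ₗ (Qs ∘ₗ Cop))
      (fun a b => B₃ * B₃ * c * Real.exp (-(ρ * g.dist a b))) := by
  have htri : Triangle254 (toB6 g R₀ H₀) := fun a b c => hG.tri a b c
  have hS : HasMaj (cNorm R₀ H₀ blkZ hG.lenle 2) (cNorm R₀ H₀ blkY hG.lenle 1) ((Dop ∘ₗ G0 ∘ₗ Qs) ∘ₗ Cop)
      (fun a b => (cNorm R₀ H₀ blkZ hG.lenle 0 (X := Z)).κ * B₃ * B₃ * c * Real.exp (-(ρ * g.dist a b))) :=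
    hasMaj_comp_exp htri hG.dnn hrow hB₃ hB₃ hρ (by linarith) hρ₃ hDQs hCop
  simp only [cNorm_κ, one_mul] at hS
  exact hS.congr fun b => rfl

/-! ## §2 The sup conjunct of (3.133) for `H♭` from the three letters and the co-reading -/

/-- ★★ **(3.133) AT SLOT (a), THE TWO SUP MEMBERS, FROM THREE LETTERS** (print's n = 0 term of Theorem 3.12's proof): if the H-kernel `Hk` of a member is CO-READ at `U` by
`H♭ = G₀Q*C♭` (n = 0) and by `∇_UH♭ = ∇_UG₀Q*C♭` (n = 1), the letters `gQs2 ∕ dgQs` (Theorem 3.3's right entries `G₀Q*`, `∇_UG₀Q*`, constant `B₃`, rate `δ₃`) and `c2♭` (the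
(3.132)-analogue for `C♭ = (QG₀Q*)⁻¹` in the transferred classes) hold, [4] (2.61) holds at rate `σ` with constant `c`, and the class ratio `(Lʲη∕L^{j′}η)²` transfers at rate `αρ`
with constant `Λ` (p. 398's remark), THEN `|H♭_{μν}(x,y′)| ≤ C·(L^{j′}η)^{−d}e^{−½δ₁d}`, `|∇H♭_{μν}(x,y′)| ≤ C·(Lʲη)⁻¹(L^{j′}η)^{−d}e^{−½δ₁d}` with `C = B₃²cΛ`, `δ₁ = 2(1−α)ρ` —
the sup conjunct of `B9.Ineq3133 d Hk C · δ₁ U` verbatim. [cite: Balaban1985BackgroundPropagators, (3.133) p.422 + (3.126) p.420 + (3.130)–(3.132) pp.421–422 + p.398; Balaban1984PropagatorsII, (2.60)–(2.61) p.234] -/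
theorem ineq3133flat_sup_of_letters {R₀ : ℝ} {H₀ : Prop} (hG : GeoOK g) {Hk : B9.HKernel g B} {U : B.Cfg} {d : ℕ}
    {blk : X → g.Site} {blkY : Y → g.Site} {blkZ : Z → g.Site} {G0 : Module.End ℝ (X → ℝ)} {Dop : (X → ℝ) →ₗ[ℝ] (Y → ℝ)}
    {Qs : (Z → ℝ) →ₗ[ℝ] (X → ℝ)} {Cop : Module.End ℝ (Z → ℝ)} {B₃ δ₃ ρ σ c α Λ : ℝ}
    (hrow : RowSum (toB6 g R₀ H₀) σ c) (hB₃ : 0 ≤ B₃) (hσ : 0 ≤ σ) (hρ : 0 ≤ ρ) (hρ₃ : ρ + σ ≤ δ₃) (hc : 0 ≤ c) (hΛ : 0 ≤ Λ)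
    (hQs : HasMaj (cNorm R₀ H₀ blkZ hG.lenle 0) (cNorm R₀ H₀ blk hG.lenle 2) (G0 ∘ₗ Qs) (fun a b => B₃ * Real.exp (-(δ₃ * g.dist a b))))
    (hDQs : HasMaj (cNorm R₀ H₀ blkZ hG.lenle 0) (cNorm R₀ H₀ blkY hG.lenle 1) (Dop ∘ₗ G0 ∘ₗ Qs)
      (fun a b => B₃ * Real.exp (-(δ₃ * g.dist a b))))
    (hCop : HasMaj (cNorm R₀ H₀ blkZ hG.lenle 2) (cNorm R₀ H₀ blkZ hG.lenle 0) Cop (fun a b => B₃ * Real.exp (-(δ₃ * g.dist a b))))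
    (hC0 : CoRealizesH Hk 0 U d blk blkZ (G0 ∘ₗ (Qs ∘ₗ Cop))) (hC1 : CoRealizesH Hk 1 U d blkY blkZ (Dop ∘ₗ G0 ∘ₗ (Qs ∘ₗ Cop)))
    (hST : B9Ineq347.ScaleTransfer g ρ α Λ (fun y => g.len y ^ (2 : ℝ))) :
    ∀ (n : Fin 2) (y y' : g.Site),
      Hk.e n U y y' ≤ (B₃ * B₃ * c * Λ) * (g.len y) ^ (-(n : ℝ)) * (g.len y') ^ (-(d : ℝ)) * Real.exp (-((2 * ((1 - α) * ρ)) / 2 * g.dist y y')) := by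
  have hK0 : 0 ≤ B₃ * B₃ * c := mul_nonneg (mul_nonneg hB₃ hB₃) hc
  have h0 := hk_e0_of_hasMaj hG hK0 hΛ hC0 hST (Hflat_entry0 hG hrow hB₃ hσ hρ hρ₃ hQs hCop)
  have h1 := hk_e1_of_hasMaj hG hK0 hΛ hC1 hST (Hflat_entry1 hG hrow hB₃ hσ hρ hρ₃ hDQs hCop)
  refine ineq3133_sup_of_entries hG.lenpos (C₀ := B₃ * B₃ * c * Λ) (C₁ := B₃ * B₃ * c * Λ) le_rfl le_rfl (τ := (1 - α) * ρ)
    (fun y y' => ?_) (fun y y' => ?_)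
  · simpa only [mul_assoc] using h0 y y'
  · simpa only [mul_assoc] using h1 y y'

end

end Literature.MathematicalPhysics.QuantumFieldTheory.Balaban1983to89.B9Eq3133SlotAH
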